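import Summits.CriticalPhenomena.PercolationContinuityZ3.Theorems.PercNearOneGluingNoHeavyLowerTailFrontierDecRowsLeFive
import Summits.CriticalPhenomena.PercolationContinuityZ3.Theorems.PercNearOneGluingNoHeavyLowerTailFrontierDecRowsPinnedEdgeInduction
import HarnessLib

/-!
# The four-point dec cubic frontier: rows 12, 27, 30 follow from row 44 — literal-dropping monotonicity of Sahi's `E₃`

Support file (prover prim-ineq-prove-3 gen 10; `--supports stmt-CriticalPhenomena-4575`).  No definitions beyond bookkeeping, no named facts, no sorries,
no `native_decide`.

Of the 45 essential `S₄`-orbits of decreasing four-point `E₃` rows (`…FrontierDecRowsLeFive`), seven are open for general `n`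
(`…FrontierDecRowsClusterMarkov/…Kill/…OneSource/…FreeVertexSplit`): tree rows `12, 15, 27, 30, 36, 37, 44`.  This file shows that three of them are
CONSEQUENCES of row `44`, pointwise in the law (every `n`, every weight, every placement):
  `E₃(row 27 at (a,b,c,y)) ≥ E₃(row 12 at (a,b,c,y)) ≥ E₃(row 44 at (a,c,b,y))`,   `E₃(row 30 at (a,b,c,y)) ≥ E₃(row 12 at (a,b,c,y))`,
so the open frontier has at most FOUR independent members: `15, 36 (PATH), 37, 44`.

THE LEMMA (`sahiE3_dropLiteral_le`, any finite measure).  If `X ⊆ X'`, `X' ∩ C ⊆ X` (the two events agree on `C`) and `μ(C)μ(Y) ≤ μ(C ∩ Y)`, then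
`E₃(X', C, Y) ≤ E₃(X, C, Y)`.  Proof: with `X ∩ C = X' ∩ C`,
  `E₃(X,C,Y) − E₃(X',C,Y) = (μX' − μX)·(μ(C∩Y) − μCμY) + μC·(μ(X'∩Y) − μ(X∩Y)) ≥ 0`.
APPLICATION.  A group separation that shares a literal with the middle event `C = D[ac|by]` may drop it:  `D[ab|c] ∩ C = D[a|c] ∩ C` (the literal `b≁c`
is in `C`), `D[ab|y] ∩ C = D[b|y] ∩ C` (`a≁y ∈ C`), `D[b|cy] ∩ C = D[b|y] ∩ C` (`b≁c ∈ C`); Harris (`TerminalEdgeInduction.real_mul_le_inter_sep`) supplies `μ(C)μ(Y) ≤ μ(C∩Y)`.  Hence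
  row 12 `(D[ab|c], D[ac|by], D[b|y])` ≥ `(D[a|c], D[ac|by], D[b|y])` = row 44 at `(a,c,b,y)`;
  row 27 `(D[ab|c], D[ab|y], D[ac|by])` ≥ `(D[ab|c], D[b|y], D[ac|by])` = row 12;   row 30 `(D[ab|c], D[ac|by], D[b|cy])` ≥ row 12.
(Found by an exact-law dominance scan over the seven open orbits, prim-ineq-prove-3 gen 10 lab/dominance.py: these are the ONLY pointwise dominances among them.)
-/

noncomputable section

namespace Summit.CriticalPhenomena.PercolationContinuityZ3.Theorems.FrontierDecRows

open MeasureTheory CovTransferCert E3GroupSepCert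
open Literature.Probability.Percolation Literature.Probability.LatticeModels

/-! ### The abstract lemma -/

/-- **Literal-dropping monotonicity of `E₃` in its first slot.**  If `X ⊆ X'`, `X' ∩ C ⊆ X` and `C, Y` are positively correlated, then
`E₃(X', C, Y) ≤ E₃(X, C, Y)`. [this work] -/
theorem sahiE3_dropLiteral_le {Ω : Type*} [MeasurableSpace Ω] (μ : Measure Ω) [IsFiniteMeasure μ] {X X' C Y : Set Ω}
    (hXX' : X ⊆ X') (hX'C : X' ∩ C ⊆ X) (hCY : μ.real C * μ.real Y ≤ μ.real (C ∩ Y)) :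
    sahiE3 μ X' C Y ≤ sahiE3 μ X C Y := by
  have e1 : X ∩ C = X' ∩ C :=
    Set.Subset.antisymm (Set.inter_subset_inter_left C hXX') fun ω h => ⟨hX'C h, h.2⟩
  have e2 : X ∩ C ∩ Y = X' ∩ C ∩ Y := by rw [e1]
  have h1 : μ.real X ≤ μ.real X' := measureReal_mono hXX'
  have h2 : μ.real (X ∩ Y) ≤ μ.real (X' ∩ Y) := measureReal_mono (Set.inter_subset_inter_left Y hXX')
  have hC0 : 0 ≤ μ.real C := measureReal_nonneg
  have f1 : μ.real X * (μ.real (C ∩ Y) - μ.real C * μ.real Y) ≤ μ.real X' * (μ.real (C ∩ Y) - μ.real C * μ.real Y) :=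
    mul_le_mul_of_nonneg_right h1 (sub_nonneg.2 hCY)
  have f2 : μ.real C * μ.real (X ∩ Y) ≤ μ.real C * μ.real (X' ∩ Y) := mul_le_mul_of_nonneg_left h2 hC0
  rw [sahiE3_def, sahiE3_def, e2, e1]
  nlinarith [f1, f2]

/-- The same in the third slot: `X ⊆ X'`, `X' ∩ C ⊆ X`, `μ(C)μ(Y) ≤ μ(C ∩ Y)` give `E₃(Y, C, X') ≤ E₃(Y, C, X)`. [this work] -/
theorem sahiE3_dropLiteral_le₃ {Ω : Type*} [MeasurableSpace Ω] (μ : Measure Ω) [IsFiniteMeasure μ] {X X' C Y : Set Ω}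
    (hXX' : X ⊆ X') (hX'C : X' ∩ C ⊆ X) (hCY : μ.real C * μ.real Y ≤ μ.real (C ∩ Y)) :
    sahiE3 μ Y C X' ≤ sahiE3 μ Y C X := by
  rw [sahiE3_comm₁₂ μ Y C X', sahiE3_comm₂₃ μ C Y X', sahiE3_comm₁₂ μ C X' Y, sahiE3_comm₁₂ μ Y C X, sahiE3_comm₂₃ μ C Y X,
    sahiE3_comm₁₂ μ C X Y]
  exact sahiE3_dropLiteral_le μ hXX' hX'C hCY

/-! ### Percolation bookkeeping: separation events are decreasing; literals -/

variable {n : ℕ}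

/-- Membership in a group-separation event. [this work] -/
theorem mem_connEvent_sep {X Y : List (Fin n)} {ω : BondConfig (Fin n)} :
    ω ∈ connEvent (sep X Y) ↔ ∀ x ∈ X, ∀ y ∈ Y, ω ∉ openConn x y := by
  rw [connEvent_sep]; rfl

/-- `openConn` is symmetric at the level of membership. [folklore] -/
theorem not_mem_openConn_comm {x y : Fin n} {ω : BondConfig (Fin n)} (h : ω ∉ openConn x y) : ω ∉ openConn y x :=
  fun h' => h (SimpleGraph.Reachable.symm h')

/-! ### The three dominances -/

variable (w : Sym2 (Fin n) → unitInterval) (a b c y : Fin n)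

/-- **Row 12 dominates row 44 (relabelled):** `E₃(D[a|c], D[ac|by], D[b|y]) ≤ E₃(D[ab|c], D[ac|by], D[b|y])`. [this work] -/
theorem sahiE3_row44'_le_row12 :
    sahiE3 (prodBernoulli w) (connEvent (sep [a] [c])) (connEvent (sep [a, c] [b, y])) (connEvent (sep [b] [y])) ≤
      sahiE3 (prodBernoulli w) (connEvent (sep [a, b] [c])) (connEvent (sep [a, c] [b, y])) (connEvent (sep [b] [y])) := by
  refine sahiE3_dropLiteral_le (prodBernoulli w) ?_ ?_ (TerminalEdgeInduction.real_mul_le_inter_sep w [a, c] [b, y] [b] [y])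
  · intro ω hω
    rw [mem_connEvent_sep] at hω ⊢
    intro x hx z hz
    simp only [List.mem_singleton] at hx hz
    subst hx; subst hz
    exact hω x (by simp) z (by simp)
  · rintro ω ⟨h1, h2⟩
    rw [mem_connEvent_sep] at h1 h2 ⊢
    intro x hx z hz
    simp only [List.mem_cons, List.not_mem_nil, or_false] at hx hz
    subst hz
    rcases hx with rfl | rfl
    · exact h1 x (by simp) z (by simp)
    · exact not_mem_openConn_comm (h2 z (by simp) x (by simp))

/-- **Row 27 dominates row 12:** `E₃(D[ab|c], D[b|y], D[ac|by]) ≤ E₃(D[ab|c], D[ab|y], D[ac|by])`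
(stated with the slots of row 12 / row 27 as filed: `(D[ab|c], D[ac|by], D[b|y])` and `(D[ab|c], D[ab|y], D[ac|by])`). [this work] -/
theorem sahiE3_row12_le_row27 :
    sahiE3 (prodBernoulli w) (connEvent (sep [a, b] [c])) (connEvent (sep [a, c] [b, y])) (connEvent (sep [b] [y])) ≤
      sahiE3 (prodBernoulli w) (connEvent (sep [a, b] [c])) (connEvent (sep [a, b] [y])) (connEvent (sep [a, c] [b, y])) := by
  -- bring both sides to the form `E₃(·, C, D[ab|c])` with the varying event in the first slot
  have eL : sahiE3 (prodBernoulli w) (connEvent (sep [a, b] [c])) (connEvent (sep [a, c] [b, y])) (connEvent (sep [b] [y])) =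
      sahiE3 (prodBernoulli w) (connEvent (sep [b] [y])) (connEvent (sep [a, c] [b, y])) (connEvent (sep [a, b] [c])) := by
    rw [sahiE3_comm₁₂, sahiE3_comm₂₃, sahiE3_comm₁₂]
  have eR : sahiE3 (prodBernoulli w) (connEvent (sep [a, b] [c])) (connEvent (sep [a, b] [y])) (connEvent (sep [a, c] [b, y])) =
      sahiE3 (prodBernoulli w) (connEvent (sep [a, b] [y])) (connEvent (sep [a, c] [b, y])) (connEvent (sep [a, b] [c])) := by
    rw [sahiE3_comm₁₂, sahiE3_comm₂₃]
  rw [eL, eR]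
  refine sahiE3_dropLiteral_le (prodBernoulli w) ?_ ?_ (TerminalEdgeInduction.real_mul_le_inter_sep w [a, c] [b, y] [a, b] [c])
  · intro ω hω
    rw [mem_connEvent_sep] at hω ⊢
    intro x hx z hz
    simp only [List.mem_singleton] at hx hz
    subst hx; subst hz
    exact hω x (by simp) z (by simp)
  · rintro ω ⟨h1, h2⟩
    rw [mem_connEvent_sep] at h1 h2 ⊢
    intro x hx z hz
    simp only [List.mem_cons, List.not_mem_nil, or_false] at hx hz
    subst hz
    rcases hx with rfl | rfl
    · exact h2 x (by simp) z (by simp)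
    · exact h1 x (by simp) z (by simp)

/-- **Row 30 dominates row 12:** `E₃(D[ab|c], D[ac|by], D[b|y]) ≤ E₃(D[ab|c], D[ac|by], D[b|cy])`. [this work] -/
theorem sahiE3_row12_le_row30 :
    sahiE3 (prodBernoulli w) (connEvent (sep [a, b] [c])) (connEvent (sep [a, c] [b, y])) (connEvent (sep [b] [y])) ≤
      sahiE3 (prodBernoulli w) (connEvent (sep [a, b] [c])) (connEvent (sep [a, c] [b, y])) (connEvent (sep [b] [c, y])) := by
  refine sahiE3_dropLiteral_le₃ (prodBernoulli w) ?_ ?_ (TerminalEdgeInduction.real_mul_le_inter_sep w [a, c] [b, y] [a, b] [c])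
  · intro ω hω
    rw [mem_connEvent_sep] at hω ⊢
    intro x hx z hz
    simp only [List.mem_singleton] at hx hz
    subst hx; subst hz
    exact hω x (by simp) z (by simp)
  · rintro ω ⟨h1, h2⟩
    rw [mem_connEvent_sep] at h1 h2 ⊢
    intro x hx z hz
    simp only [List.mem_cons, List.not_mem_nil, or_false] at hx hz
    subst hx
    rcases hz with rfl | rfl
    · exact not_mem_openConn_comm (h2 z (by simp) x (by simp))
    · exact h1 x (by simp) z (by simp)

/-! ### Frontier rows 12, 27, 30 from row 44 (all `n`) -/

/-- Row `44` at `(a, c, b, y)` is `(D[ac|by], D[a|c], D[b|y])`. [this work] -/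
theorem row44_acby : row 44 n (a, c, b, y) = (sep [a, c] [b, y], sep [a] [c], sep [b] [y]) := rfl
/-- Row `12` at `(a, b, c, y)` is `(D[ab|c], D[ac|by], D[b|y])`. [this work] -/
theorem row12_abcy : row 12 n (a, b, c, y) = (sep [a, b] [c], sep [a, c] [b, y], sep [b] [y]) := rfl
/-- Row `27` at `(a, b, c, y)` is `(D[ab|c], D[ab|y], D[ac|by])`. [this work] -/
theorem row27_abcy : row 27 n (a, b, c, y) = (sep [a, b] [c], sep [a, b] [y], sep [a, c] [b, y]) := rfl
/-- Row `30` at `(a, b, c, y)` is `(D[ab|c], D[ac|by], D[b|cy])`. [this work] -/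
theorem row30_abcy : row 30 n (a, b, c, y) = (sep [a, b] [c], sep [a, c] [b, y], sep [b] [c, y]) := rfl

/-- **Row 12 ≥ row 44 (relabelled), in the `row` vocabulary.** [this work] -/
theorem sahiE3_row12_ge_row44 :
    sahiE3 (prodBernoulli w) (connEvent (row 44 n (a, c, b, y)).1) (connEvent (row 44 n (a, c, b, y)).2.1)
        (connEvent (row 44 n (a, c, b, y)).2.2) ≤
      sahiE3 (prodBernoulli w) (connEvent (row 12 n (a, b, c, y)).1) (connEvent (row 12 n (a, b, c, y)).2.1)
        (connEvent (row 12 n (a, b, c, y)).2.2) := by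
  rw [row44_acby, row12_abcy]
  dsimp only
  rw [sahiE3_comm₁₂ (prodBernoulli w) (connEvent (sep [a, c] [b, y]))]
  exact sahiE3_row44'_le_row12 w a b c y

/-- **Row 27 ≥ row 12, in the `row` vocabulary.** [this work] -/
theorem sahiE3_row27_ge_row12 :
    sahiE3 (prodBernoulli w) (connEvent (row 12 n (a, b, c, y)).1) (connEvent (row 12 n (a, b, c, y)).2.1)
        (connEvent (row 12 n (a, b, c, y)).2.2) ≤
      sahiE3 (prodBernoulli w) (connEvent (row 27 n (a, b, c, y)).1) (connEvent (row 27 n (a, b, c, y)).2.1)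
        (connEvent (row 27 n (a, b, c, y)).2.2) := by
  rw [row27_abcy, row12_abcy]
  exact sahiE3_row12_le_row27 w a b c y

/-- **Row 30 ≥ row 12, in the `row` vocabulary.** [this work] -/
theorem sahiE3_row30_ge_row12 :
    sahiE3 (prodBernoulli w) (connEvent (row 12 n (a, b, c, y)).1) (connEvent (row 12 n (a, b, c, y)).2.1)
        (connEvent (row 12 n (a, b, c, y)).2.2) ≤
      sahiE3 (prodBernoulli w) (connEvent (row 30 n (a, b, c, y)).1) (connEvent (row 30 n (a, b, c, y)).2.1)
        (connEvent (row 30 n (a, b, c, y)).2.2) := by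
  rw [row30_abcy, row12_abcy]
  exact sahiE3_row12_le_row30 w a b c y

/-- **Rows 12, 27 and 30 of the frontier on EVERY finite weighted graph follow from row 44 on every finite weighted graph (same `n`).**
Hypothesis: row `44` `(D[ab|cy], D[a|b], D[c|y])` for all placements; conclusions: rows `12`, `27`, `30` for all placements. [this work] -/
theorem frontier_12_27_30_all_of_frontier_44_all
    (h44 : ∀ (a b c y : Fin n), 0 ≤ sahiE3 (prodBernoulli w) (connEvent (row 44 n (a, b, c, y)).1)
      (connEvent (row 44 n (a, b, c, y)).2.1) (connEvent (row 44 n (a, b, c, y)).2.2)) (a b c y : Fin n) :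
    0 ≤ sahiE3 (prodBernoulli w) (connEvent (row 12 n (a, b, c, y)).1) (connEvent (row 12 n (a, b, c, y)).2.1)
        (connEvent (row 12 n (a, b, c, y)).2.2) ∧
    0 ≤ sahiE3 (prodBernoulli w) (connEvent (row 27 n (a, b, c, y)).1) (connEvent (row 27 n (a, b, c, y)).2.1)
        (connEvent (row 27 n (a, b, c, y)).2.2) ∧
    0 ≤ sahiE3 (prodBernoulli w) (connEvent (row 30 n (a, b, c, y)).1) (connEvent (row 30 n (a, b, c, y)).2.1)
        (connEvent (row 30 n (a, b, c, y)).2.2) := by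
  have h12 := (h44 a c b y).trans (sahiE3_row12_ge_row44 w a b c y)
  exact ⟨h12, h12.trans (sahiE3_row27_ge_row12 w a b c y), h12.trans (sahiE3_row30_ge_row12 w a b c y)⟩

/-- Rows 27 and 30 from row 12 alone. [this work] -/
theorem frontier_27_30_all_of_frontier_12_all
    (h12 : ∀ (a b c y : Fin n), 0 ≤ sahiE3 (prodBernoulli w) (connEvent (row 12 n (a, b, c, y)).1)
      (connEvent (row 12 n (a, b, c, y)).2.1) (connEvent (row 12 n (a, b, c, y)).2.2)) (a b c y : Fin n) :
    0 ≤ sahiE3 (prodBernoulli w) (connEvent (row 27 n (a, b, c, y)).1) (connEvent (row 27 n (a, b, c, y)).2.1)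
        (connEvent (row 27 n (a, b, c, y)).2.2) ∧
    0 ≤ sahiE3 (prodBernoulli w) (connEvent (row 30 n (a, b, c, y)).1) (connEvent (row 30 n (a, b, c, y)).2.1)
        (connEvent (row 30 n (a, b, c, y)).2.2) :=
  ⟨(h12 a b c y).trans (sahiE3_row27_ge_row12 w a b c y), (h12 a b c y).trans (sahiE3_row30_ge_row12 w a b c y)⟩

end Summit.CriticalPhenomena.PercolationContinuityZ3.Theorems.FrontierDecRows
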